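import Literature.NumberTheory.PAdicHodge.BmaxPlusBdRModFilPeriods
import Literature.NumberTheory.PAdicHodge.BmaxPlusBdRModFilTheta
import Literature.NumberTheory.PAdicHodge.BmaxPlusLogSeriesFrobenius
import Literature.NumberTheory.PAdicHodge.BmaxPlusTRegular
import Literature.NumberTheory.PAdicHodge.BdRPlusLogLatticeKernel
import HarnessLib

/-!
# `(A_max)^{φ=p} ⊆ ℚ_p·t + ℚ_p·log[1 + 𝔪♭]`: every Frobenius eigenvector of `A_max` with eigenvalue `p` is a Teichmüller logarithm plus a
# multiple of `t`, modulo Fontaine's kernel lemma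

Topic `Literature/NumberTheory/PAdicHodge`; namespace `Literature.NumberTheory.PAdicHodge`. THEOREMS ONLY (no definition, no named fact, no
instance, no `sorry`). The «log-surjectivity» step of the φ-road of line `kato_lever` (crux K★ `stmt-BirchSwinnertonDyer-22226`, memos
`Summits/…/Cruxes/StarredOptimalManinUnitFiveSeven/Lines/kato-lever-K2-phi-road.md` §1 B8, `…-K2-fontaine-lemma-g24.md` §3,
`…-K3-legendre.md` §7.3 (iii)): the passage from «`φx = px`» to the socket's explicit currency `X = ℚ_p·log[1+𝔪♭]` of Teichmüller logarithms —
the surjectivity half of Fontaine's `(B⁺_cris)^{φ=p} = ℚ_p ⊗ log[1 + 𝔪_{ℂ♭}]`, in Colmez's `A_max = B_max⁺(F)`: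

* ★ `thetaBmaxPlus_logSum_teichmuller_sub_one_eq` — **`θ_max(Λ^{log}_1([w] − 1, z)) = p·θ_dR(L′)`** for every logarithm `L′` of `[w]` modulo `Fil¹`
  (`IsLogModFil 1 ([w] − 1) L′`; `[w] − 1 ∈ (p, ξ)`): the `A_max`-valued `p`-adic logarithm `Λ^{log}_1 = p·log[w]`
  (`BmaxPlusLogSeriesFrobenius.frobBmaxPlus_logSum_teichmuller_sub_one`: `φΛ = pΛ`) has the classical value `p·log_p(w♯)` under `θ`
  (comparison `B_max⁺ → B_dR⁺/Fil¹` commutes with `θ`, `BmaxPlusBdRModFilTheta`, and carries `Λ^{log}` to `p·(log[w] mod Fil¹)`,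
  `BmaxPlusBdRModFilLogType`);
* ★★★ `exists_pow_mul_eq_tBmax_add_logSum_of_frobBmaxPlus_eq` — **MODULO FONTAINE'S KERNEL LEMMA** (hypothesis `hFK`:
  `φy = py ∧ θy = 0 ⇒ p^k y ∈ ℤ_p·t`, = `BmaxPlusFontaineKernel.fontaineKernel_of_tBmax_dvd` ⟸ (TDIV)): for every `x ∈ A_max` with `φx = p·x`
  there are `k, j ∈ ℕ`, `c ∈ ℤ_p`, `w ∈ 𝒪_{ℂ_F}♭` with `[w] − 1 ∈ (p, ξ)` (witness `ι([w] − 1) = p·z`) such that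
  **`p^k · x = c·t + p^j · Λ^{log}_1([w] − 1, z)`** — `θ` maps the logarithms onto `ℂ_F` up to `p`-powers
  (`BdRPlusLogLatticeKernel.exists_isLogModFil_thetaBdR_eq_pow_mul`: `log` onto a ball, `♯` onto `𝒪_{ℂ_F}`), so `p^n x − Λ^{log}` lies in
  `(A_max)^{φ=p} ∩ ker θ = ℤ_p·t` (up to `p`-powers).

With `t = log[ε]` this reads `(A_max)^{φ=p} ⊗ ℚ_p ⊆ ℚ_p ⊗ log[1 + 𝔪_{ℂ♭}]`; by the comparison modulo `Fil^k` (`BmaxPlusBdRModFil*`, `IsTeichLog`) it is the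
fragment of the fundamental exact sequence that B8 of the φ-road consumes. Infrastructure only; BSD / K★ are not proved by any of this.

## References
* J.-M. Fontaine, *Le corps des périodes p-adiques*, Astérisque 223 (1994), Exp. II §1.5.4, Exp. III Th. 5.3.7. [FontaineAsterisque223III]
* J.-M. Fontaine, Y. Ouyang, *Theory of p-adic Galois representations*, §6.1 (`U → (B_cris⁺)^{φ=p}`, the fundamental exact sequence). [FontaineOuyang2022]
* P. Colmez, *Théorie d'Iwasawa des représentations de de Rham d'un corps local*, Ann. of Math. 148 (1998), §III.2–III.3. [Colmez1998Annals]
-/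

noncomputable section

open WittVector Field ValuativeRel Finset
open Literature.AlgebraicGeometry.Resolution
open Literature.RingTheory.FormalGroups

namespace Literature.NumberTheory.PAdicHodge

open Literature.NumberTheory.GaloisRepresentations
open Literature.NumberTheory.GaloisRepresentations.IsNonarchimedeanLocalField
open GaloisContinuity

variable {F : Type} [Field F] [ValuativeRel F] [TopologicalSpace F] [IsNonarchimedeanLocalField F]
  [CharZero F] {p : ℕ} [Fact p.Prime] [Fact (¬ IsUnit (p : integerC F))]
  [IsAdicComplete (Ideal.span {(p : integerC F)}) (integerC F)]

/-! ## §1 `θ_max` of the `A_max`-valued Teichmüller logarithm -/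

set_option maxHeartbeats 3200000 in
/-- ★ **`θ_max(Λ^{log}_1([w] − 1, z)) = p·θ_dR(L′)` for every logarithm `L′` of `[w]` modulo `Fil¹`.** Here `w ∈ 𝒪_{ℂ_F}♭` with `[w] − 1 ∈ (p, ξ)`
(witness `ι([w] − 1) = p·z` in `B⁰_max`), `Λ^{log}_1([w] − 1, z) = p·log[w] ∈ A_max` is the `p`-adic sum with the logarithm numerators `(−1)^{m+1}`
(`PadicLogSeries.logSum`), and `IsLogModFil 1 ([w] − 1) L′` (`BdRPlusLogLattice`). Proof: the comparison `B_max⁺ → B_dR⁺/Fil¹` (`exists_bdR_lim_modFil`)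
commutes with `θ` (`thetaBdR_eq_of_bdR_lim_modFil`) and sends `Λ^{log}_1` to `p·L″` with `L″` a logarithm of `[w]` modulo `Fil¹`
(`exists_isLogTypeModFil_of_bdR_lim_modFil_logSum`), and two such logarithms differ by an element of `Fil¹ ⊆ ker θ`.
[cite: FontaineAsterisque223III, Exp. II §1.5.4] [cite: Colmez1998Annals, §III.2] -/
theorem thetaBmaxPlus_logSum_teichmuller_sub_one_eq (w : PreTilt (integerC F) p) {z : bmaxZero F p}
    (hz : algebraMap (Ainf (p := p) F) (bmaxZero F p) ((teichmuller p w : Ainf (p := p) F) - 1) ^ 1 = (p : bmaxZero F p) * z)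
    {L' : BDeRhamPlus (integerC F) p} (hL' : IsLogModFil 1 ((teichmuller p w : Ainf (p := p) F) - 1) L') :
    ((thetaBmaxPlus F p
        (PadicLogSeries.logSum ((algebraMap (Ainf (p := p) F) (bmaxZero F p)).comp zpToAinf)
          (fun m => if m = 0 then 0 else (-1) ^ (m + 1)) 1
          (algebraMap (Ainf (p := p) F) (bmaxZero F p) ((teichmuller p w : Ainf (p := p) F) - 1)) z) : integerC F) :
        CompletedAlgClosure F) =
      (p : CompletedAlgClosure F) * thetaBdR L' := by
  set Λ := PadicLogSeries.logSum ((algebraMap (Ainf (p := p) F) (bmaxZero F p)).comp zpToAinf)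
    (fun m => if m = 0 then 0 else (-1) ^ (m + 1)) 1
    (algebraMap (Ainf (p := p) F) (bmaxZero F p) ((teichmuller p w : Ainf (p := p) F) - 1)) z with hΛ
  -- a limit of `Λ` modulo `Fil¹`, its `θ`, and its identification as `p·(log[w] mod Fil¹)`
  obtain ⟨L₁, r, hL₁⟩ := exists_bdR_lim_modFil Λ 1
  have hθ₁ : thetaBdR L₁ = ((thetaBmaxPlus F p Λ : integerC F) : CompletedAlgClosure F) := thetaBdR_eq_of_bdR_lim_modFil le_rfl hL₁
  obtain ⟨L'', hL''eq, hL''⟩ := exists_isLogTypeModFil_of_bdR_lim_modFil_logSum (fun m => if m = 0 then 0 else (-1) ^ (m + 1))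
    le_rfl ((teichmuller p w : Ainf (p := p) F) - 1) hz hL₁
  have hL''' : IsLogModFil 1 ((teichmuller p w : Ainf (p := p) F) - 1) L'' := by
    rw [← isLogTypeModFil_neg_one_pow_iff]
    exact isLogTypeModFil_congr (fun m hm => by rw [if_neg hm]) hL''
  -- two logarithms of `[w]` modulo `Fil¹` have the same `θ`
  have hθeq : thetaBdR L'' = thetaBdR L' := by
    have h := thetaBdR_eq_zero_of_mem_span_xiBdR_pow le_rfl (hL'''.sub_mem_span_xiBdR_pow hL')
    rwa [map_sub, sub_eq_zero] at h
  rw [← hθ₁, ← hL''eq, pow_one, map_mul, map_natCast, hθeq]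

/-! ## §2 `(A_max)^{φ=p} ⊆ ℚ_p·t + ℚ_p·Λ^{log}[1 + 𝔪♭]`, modulo Fontaine's kernel lemma -/

set_option maxHeartbeats 3200000 in
/-- ★★★ **Every `x ∈ (A_max)^{φ=p}` is a Teichmüller logarithm plus a multiple of `t`, up to `p`-powers — modulo Fontaine's kernel lemma.**
Assume `hFK`: every `y ∈ A_max` with `φy = p·y` and `θ(y) = 0` has `p^k·y = c·t` for some `k ∈ ℕ`, `c ∈ ℤ_p`
(`BmaxPlusFontaineKernel.fontaineKernel_of_tBmax_dvd`, i.e. Fontaine's lemma `(A_max)^{φ=p} ∩ ker θ ⊆ ℚ_p·t`, modulo the `t`-divisibility (TDIV)).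
Then for every `x ∈ A_max` with `φ(x) = p·x` there are `k, j ∈ ℕ`, `c ∈ ℤ_p`, `w ∈ 𝒪_{ℂ_F}♭` with `[w] − 1 ∈ (p, ξ)𝔸_inf` and a witness
`ι([w] − 1) = p·z` in `B⁰_max`, such that **`p^k · x = c·t + p^j · Λ^{log}_1([w] − 1, z)`** (`Λ^{log}_1 = p·log[w] ∈ (A_max)^{φ=p}`,
`frobBmaxPlus_logSum_teichmuller_sub_one`). Proof: `θ` maps the Teichmüller logarithms onto `ℂ_F` up to `p`-powers
(`exists_isLogModFil_thetaBdR_eq_pow_mul`: `p^N·θ(x) = θ_dR(L′) = log_p(w♯)`), so `y := p^{N+1}·x − Λ^{log}_1([w] − 1)` has `φy = py` and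
`θ(y) = 0` (`thetaBmaxPlus_logSum_teichmuller_sub_one_eq`), whence `p^k y ∈ ℤ_p·t`. This is `(B⁺_cris)^{φ=p} ⊆ ℚ_p·t + ℚ_p ⊗ log[1+𝔪_{ℂ♭}]` read in
`A_max`. [cite: FontaineOuyang2022, §6.1] [cite: FontaineAsterisque223III, Exp. III Th. 5.3.7] [cite: Colmez1998Annals, §III.3] -/
theorem exists_pow_mul_eq_tBmax_add_logSum_of_frobBmaxPlus_eq (hp : valuation F p < 1)
    (hFK : ∀ y : BmaxPlus F p, frobBmaxPlus F p y = (p : BmaxPlus F p) * y → thetaBmaxPlus F p y = 0 →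
      ∃ (k : ℕ) (c : ℤ_[p]), (p : BmaxPlus F p) ^ k * y = ainfToBmaxPlus F p (zpToAinf c) * tBmax)
    {x : BmaxPlus F p} (hx : frobBmaxPlus F p x = (p : BmaxPlus F p) * x) :
    ∃ (k j : ℕ) (c : ℤ_[p]) (w : PreTilt (integerC F) p) (z : bmaxZero F p),
      (teichmuller p w : Ainf (p := p) F) - 1 ∈ Ideal.span {(p : Ainf (p := p) F), xi} ∧
      algebraMap (Ainf (p := p) F) (bmaxZero F p) ((teichmuller p w : Ainf (p := p) F) - 1) ^ 1 = (p : bmaxZero F p) * z ∧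
      (p : BmaxPlus F p) ^ k * x =
        ainfToBmaxPlus F p (zpToAinf c) * tBmax +
          (p : BmaxPlus F p) ^ j *
            PadicLogSeries.logSum ((algebraMap (Ainf (p := p) F) (bmaxZero F p)).comp zpToAinf)
              (fun m => if m = 0 then 0 else (-1) ^ (m + 1)) 1
              (algebraMap (Ainf (p := p) F) (bmaxZero F p) ((teichmuller p w : Ainf (p := p) F) - 1)) z := by
  haveI : CharZero (CompletedAlgClosure F) := charZero_of_injective_algebraMap (algebraMap F (CompletedAlgClosure F)).injective
  -- `p^{N} θ(x) = θ_dR(L′)` for a logarithm `L′` of some `[w]` modulo `Fil¹`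
  obtain ⟨N, w, L', hmem, hL', hθL'⟩ := exists_isLogModFil_thetaBdR_eq_pow_mul hp (k := 1) le_rfl
    ((thetaBmaxPlus F p x : integerC F) : CompletedAlgClosure F)
  -- the `A_max`-valued logarithm `Λ = Λ^{log}_1([w] − 1, z)`
  obtain ⟨z, hz⟩ := exists_algebraMap_pow_eq_natCast_mul (F := F) (p := p) (N := 1)
    (y := (teichmuller p w : Ainf (p := p) F) - 1) (by rw [pow_one]; exact hmem)
  set Λ := PadicLogSeries.logSum ((algebraMap (Ainf (p := p) F) (bmaxZero F p)).comp zpToAinf)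
    (fun m => if m = 0 then 0 else (-1) ^ (m + 1)) 1
    (algebraMap (Ainf (p := p) F) (bmaxZero F p) ((teichmuller p w : Ainf (p := p) F) - 1)) z with hΛ
  have hφΛ : frobBmaxPlus F p Λ = (p : BmaxPlus F p) * Λ := frobBmaxPlus_logSum_teichmuller_sub_one w le_rfl hz
  -- `θ(Λ) = p^{N+1} θ(x)` in `𝒪_{ℂ_F}`
  have hθΛ : thetaBmaxPlus F p Λ = (p : integerC F) ^ (N + 1) * thetaBmaxPlus F p x := by
    apply Subtype.ext
    have h := thetaBmaxPlus_logSum_teichmuller_sub_one_eq w hz hL'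
    rw [hθL'] at h
    rw [h, Subring.coe_mul, SubmonoidClass.coe_pow, coe_natCast_integerC, pow_succ]
    ring
  -- `y := p^{N+1} x − Λ ∈ (A_max)^{φ=p} ∩ ker θ`
  have hφy : frobBmaxPlus F p ((p : BmaxPlus F p) ^ (N + 1) * x - Λ) = (p : BmaxPlus F p) * ((p : BmaxPlus F p) ^ (N + 1) * x - Λ) := by
    rw [map_sub, map_mul, map_pow, map_natCast, hx, hφΛ]; ring
  have hθy : thetaBmaxPlus F p ((p : BmaxPlus F p) ^ (N + 1) * x - Λ) = 0 := by
    rw [map_sub, map_mul, map_pow, map_natCast, hθΛ, sub_self]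
  obtain ⟨k, c, hkc⟩ := hFK _ hφy hθy
  refine ⟨k + (N + 1), k, c, w, z, hmem, hz, ?_⟩
  rw [pow_add, mul_comm ((p : BmaxPlus F p) ^ k), mul_assoc, ← hkc]
  ring

end Literature.NumberTheory.PAdicHodge

end
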